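import Literature.NumberTheory.EllipticCurves.IsogenyFaltingsTraceKor2Proofs
import Literature.AlgebraicGeometry.Motives.FaltingsECOfFinitenessIProofs
import Literature.NumberTheory.EllipticCurves.AbelianVarietyBridgeProofs
import Literature.AlgebraicGeometry.Motives.TateAbelianFiniteLatticeProofs
import HarnessLib

/-!
# Faltings' isogeny theorem over `ℚ` via `a_p`: what remains is Finiteness I

The named fact `WeierstrassCurve.isIsogenous_iff_frobeniusTrace_eq` (`EllipticCurves/Isogeny`):
two globally minimal elliptic curves over `ℚ` are `ℚ`-isogenous iff `a_p(E) = a_p(E')` for all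
but finitely many primes `p` — G. Faltings, *Endlichkeitssätze für abelsche Varietäten über
Zahlkörpern*, Invent. Math. 73 (1983), §5, Korollar 2, (i) ⇔ (iii) (English translation:
Cornell–Silverman, *Arithmetic Geometry*, Ch. II, §5, Corollary 2, PDF pp. 89–90, held and read:
"(i) ⇔ (ii) follow from Theorem 4, (ii) ⇔ (iii) from Theorem 3" and Čebotarev).

State of the tree's reduction (2026-08-15). `IsogenyFaltingsTraceKor2Proofs` derives the fact from
Korollar 2 in Tate-module form at one auxiliary prime `ℓ`
(`isIsogenous_iff_exists_tateModule_hom_ne_zero W W' ℓ` for all pairs over `ℚ`), Satz 3 being the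
theorem `isSemisimpleRepresentation_rationalGaloisRepTate_holds`. `FaltingsECOfFinitenessIProofs`
derives Korollar 2 for a pair of elliptic curves by Tate's graph argument on the abelian surface
`A ⊞ A'` from three inputs: the symmetric bridge "elliptic curves are abelian varieties"
(`nonempty_abelianVarietyBridge_symm W W'`), Faltings' **Finiteness I**
(`AbelianVariety.finite_isoClasses_isogenous P`, §6 Satz 6 with Zarhin's trick; Milne, *Abelian
Varieties*, IV.1.1) and the lattice/isogeny dictionary (`AbelianVariety.exists_isogeny_range_tateModuleMap_eq P ℓ`,
supplied by quotients by finite stable subgroups `AbelianVariety.exists_quotient_isogeny P ℓ`,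
Mumford §7 Thm. 4). The bridge is now a theorem (`WeierstrassCurve.nonempty_abelianVarietyBridge_symm_holds`,
`EllipticCurves/AbelianVarietyBridgeProofs`: the plane cubic with the Bosma–Lenstra addition
morphism is an abelian-variety model, *AEC* III.3.6). Composing, the named fact follows from
exactly **two** statements of the theory of abelian varieties over `ℚ` — Finiteness I and the
dictionary (or quotients) at one prime — which is what this file records; it supersedes the
five-hypothesis assembly `isIsogenous_iff_frobeniusTrace_eq_of_finitenessI`
(`IsogenyFaltingsTraceSubspacesProofs`). Of the two, Finiteness I is Faltings' theorem itself
(heights on the moduli space, `p`-divisible groups, Hodge–Tate weights, Raynaud), the one deep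
input, as in print; no new named fact is introduced and `isIsogenous_iff_frobeniusTrace_eq_holds` is
**not** asserted here.

Update (2026-08-15, later the same day). The quotient fact is now a theorem of the tree:
`AbelianVariety.exists_quotient_isogeny_holds` (`Motives/TateAbelianFiniteLatticeProofs`: the
quotient `P → P/S` of an abelian variety by a finite `Γ_K`-stable subgroup, built in
`AbelianVarietyQuotient*` as a relative `Spec` of invariants — Mumford §7 Thm. 4, §12 Thm. 1 —
with the factorisation of `[ℓⁿ]`, Kieffer 2024, Prop. 1.1.10–1.1.13). Feeding it in,
`isIsogenous_iff_frobeniusTrace_eq_of_finite_isoClasses_isogenous` derives the named fact from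
**Finiteness I over `ℚ` alone** — the single remaining undischarged input, and the one deep
theorem of Faltings' paper (§6 Satz 6). With a discharge
`AbelianVariety.finite_isoClasses_isogenous_holds` over `ℚ` the fact is the one-liner
`isIsogenous_iff_frobeniusTrace_eq_of_finite_isoClasses_isogenous (fun P ↦ finite_isoClasses_isogenous_holds P)`;
it is still **not** asserted here.

## Contents (all proved)

* `isIsogenous_iff_frobeniusTrace_eq_of_finitenessI_lattice`: the named fact from Finiteness I and
  the sublattice dictionary for all abelian varieties over `ℚ`, at one prime `ℓ`.
* `isIsogenous_iff_frobeniusTrace_eq_of_finitenessI_quotient`: the same with the dictionary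
  supplied by the quotient fact `exists_quotient_isogeny P ℓ`.
* `isIsogenous_iff_frobeniusTrace_eq_of_finite_isoClasses_isogenous`: the named fact from
  Finiteness I for all abelian varieties over `ℚ` alone (quotients being the theorem
  `AbelianVariety.exists_quotient_isogeny_holds`; the auxiliary prime fixed to `ℓ = 2`).

## References

* [Faltings1983Endlichkeit] G. Faltings, Invent. Math. 73 (1983), 349–366, §5 Sätze 3–4,
  Korollar 1–2; §6 Satz 6. doi:10.1007/bf01388432.
* [Faltings1986FinitenessTranslation] English translation, Cornell–Silverman (eds.), *Arithmetic
  Geometry*, Springer 1986, Ch. II, §5 Theorems 3–4, Corollaries 1–2 (held: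
  `book:cornellnd-arithmetic-geometry`, PDF pp. 89–90; read).
* [MilneAV2008] J. S. Milne, *Abelian Varieties* (2008), Ch. IV, Thm. 1.1, Lemma 2.4, Thm. 2.5.
* [Tate1966Endomorphisms] J. Tate, Invent. Math. 2 (1966), §2.
* [MumfordAV1970] D. Mumford, *Abelian Varieties* (1970), §7 Thm. 4, §12 Thm. 1 (quotients by
  finite subgroups).
* [Kieffer2024IsogenyGraphs] J. Kieffer, *Isogeny graphs of abelian varieties over finite fields*
  (2024), Prop. 1.1.10, 1.1.12–1.1.13 (the factorisation of `[ℓⁿ]` through the quotient).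
* [SilvermanAEC2009] J. H. Silverman, *The Arithmetic of Elliptic Curves*, 2nd ed., III.3.6,
  III.7.4, III.7.7.

## Design choices

Theorems only (a pure proof file, no statement or definition); `noncomputable section`; the
auxiliary prime `ℓ` explicit as in `IsogenyFaltingsTraceKor2Proofs` (and fixed to `2` in the
Finiteness-I-only assembly, whose statement no longer mentions it); the abelian-variety facts
quantified over all abelian varieties over `ℚ` exactly as in `FaltingsECOfFinitenessIProofs`.
Deliberate dot-notation extensions of Mathlib's `WeierstrassCurve` namespace next to the
assemblies they refine.
-/

noncomputable section

namespace WeierstrassCurve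

open Literature.AlgebraicGeometry.Motives

variable (ℓ : ℕ) [Fact ℓ.Prime]

/-- **Faltings' isogeny theorem over `ℚ` via `a_p`, from Finiteness I and the sublattice
dictionary.** Granted, for every abelian variety `P` over `ℚ`, Faltings' Finiteness I
(`finite_isoClasses_isogenous P`: up to isomorphism only finitely many abelian varieties over `ℚ`
are isogenous to `P`) and, at one auxiliary prime `ℓ`, the lattice/isogeny dictionary
(`exists_isogeny_range_tateModuleMap_eq P ℓ`: every `Γ`-stable `ℤ_ℓ`-sublattice of `T_ℓ P`
containing `ℓⁿ T_ℓ P` is `f (T_ℓ B)` for isogenies `f : B → P`, `h : P → B` factoring `[ℓⁿ]`),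
two globally minimal elliptic curves over `ℚ` are `ℚ`-isogenous iff `a_p(W) = a_p(W')` for all
but finitely many primes `p` (Faltings 1983, §5 Korollar 2, (i) ⇔ (iii)). Proof:
`isIsogenous_iff_frobeniusTrace_eq_of_kor2` with Korollar 2 for each pair from
`isIsogenous_iff_exists_tateModule_hom_ne_zero_of_finitenessI_of_bridge_symm` (Tate's graph
argument on `A ⊞ A'`) and the bridge theorem `nonempty_abelianVarietyBridge_symm_holds`.
[cite: Faltings1983Endlichkeit, §5 Korollar 2, (i) ⇔ (iii), with §6 Satz 6] -/
theorem isIsogenous_iff_frobeniusTrace_eq_of_finitenessI_lattice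
    (hfin : ∀ P : AbelianVariety ℚ, AbelianVariety.finite_isoClasses_isogenous P)
    (hlat : ∀ P : AbelianVariety ℚ, AbelianVariety.exists_isogeny_range_tateModuleMap_eq P ℓ) :
    isIsogenous_iff_frobeniusTrace_eq :=
  isIsogenous_iff_frobeniusTrace_eq_of_kor2 ℓ fun W W' ↦
    isIsogenous_iff_exists_tateModule_hom_ne_zero_of_finitenessI_of_bridge_symm W W' ℓ
      (nonempty_abelianVarietyBridge_symm_holds W W') hfin hlat

/-- **Faltings' isogeny theorem over `ℚ` via `a_p`, from Finiteness I and quotients.** As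
`isIsogenous_iff_frobeniusTrace_eq_of_finitenessI_lattice`, with the dictionary supplied by
quotients of abelian varieties over `ℚ` by finite `Γ`-stable subgroups with the factorisation of
`[ℓⁿ]` (`exists_quotient_isogeny P ℓ`; Mumford, *Abelian Varieties*, §7 Thm. 4), through
`isIsogenous_iff_exists_tateModule_hom_ne_zero_of_finitenessI_of_bridge_symm_of_quotient`. With
discharges of `AbelianVariety.finite_isoClasses_isogenous` and `AbelianVariety.exists_quotient_isogeny`
over `ℚ` (at any one prime, e.g. `ℓ = 2`) this is `isIsogenous_iff_frobeniusTrace_eq_holds`.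
[cite: Faltings1983Endlichkeit, §5 Korollar 2, (i) ⇔ (iii), with §6 Satz 6] -/
theorem isIsogenous_iff_frobeniusTrace_eq_of_finitenessI_quotient
    (hfin : ∀ P : AbelianVariety ℚ, AbelianVariety.finite_isoClasses_isogenous P)
    (hquot : ∀ P : AbelianVariety ℚ, AbelianVariety.exists_quotient_isogeny P ℓ) :
    isIsogenous_iff_frobeniusTrace_eq :=
  isIsogenous_iff_frobeniusTrace_eq_of_kor2 ℓ fun W W' ↦
    isIsogenous_iff_exists_tateModule_hom_ne_zero_of_finitenessI_of_bridge_symm_of_quotient W W' ℓ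
      (nonempty_abelianVarietyBridge_symm_holds W W') hfin hquot

/-- **Faltings' isogeny theorem over `ℚ` via `a_p`, from Finiteness I alone.** Granted, for
every abelian variety `P` over `ℚ`, Faltings' Finiteness I (`finite_isoClasses_isogenous P`: up
to isomorphism only finitely many abelian varieties over `ℚ` are isogenous to `P`; Faltings 1983,
§6 Satz 6 with Zarhin's trick; Milne, *Abelian Varieties*, IV Thm. 1.1), two globally minimal
elliptic curves over `ℚ` are `ℚ`-isogenous iff `a_p(W) = a_p(W')` for all but finitely many
primes `p` (Faltings 1983, §5 Korollar 2, (i) ⇔ (iii)). This is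
`isIsogenous_iff_frobeniusTrace_eq_of_finitenessI_quotient` at the auxiliary prime `ℓ = 2` (any
prime would do) with the quotient input supplied by the theorem
`AbelianVariety.exists_quotient_isogeny_holds`
(quotients of abelian varieties over `ℚ` by finite `Γ`-stable subgroups with the factorisation of
`[ℓⁿ]`; Mumford §7 Thm. 4). Every other step of the printed proof — Satz 3, the bridge
"elliptic curves are abelian varieties", biproducts, Tate's graph argument on `A ⊞ A'`, the
Frobenius-density replacement of Čebotarev — is a theorem of the tree, so Finiteness I over `ℚ`
is the only undischarged input left.
[cite: Faltings1983Endlichkeit, §5 Korollar 2, (i) ⇔ (iii), with §6 Satz 6] -/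
theorem isIsogenous_iff_frobeniusTrace_eq_of_finite_isoClasses_isogenous
    (hfin : ∀ P : AbelianVariety ℚ, AbelianVariety.finite_isoClasses_isogenous P) :
    isIsogenous_iff_frobeniusTrace_eq :=
  haveI : Fact (Nat.Prime 2) := ⟨Nat.prime_two⟩
  isIsogenous_iff_frobeniusTrace_eq_of_finitenessI_quotient 2 hfin fun P ↦
    AbelianVariety.exists_quotient_isogeny_holds P 2

end WeierstrassCurve

end
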